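import Literature.Geometry.DiscreteGeometry.SphericalCodeHullEuler
import Literature.Geometry.DiscreteGeometry.PolygonalConeVertices
import HarnessLib

/-!
# The angles of the facets at a vertex of the hull of a spherical code sum to `2π`

Topic `Literature/Geometry/DiscreteGeometry`.  Vertex form of the face theory of spherical
subdivisions (`SphericalCodeHullEuler.lean`: facets of `conv X` for a finite set `X` of unit
vectors of `ℝ³` with `0 ∈ interior (conv X)`, their cyclically ordered vertices `facetVertex`
and the identification `argmaxCone (facetNormals X) c = polyCone` of the cone over a facet;
`PolygonalConeVertices.lean`: the cone of feasible directions of a polygonal cone at a vertex is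
the dihedral wedge of the two facets through it, of ball fraction `polyDih / 2π`;
`ConeTiling.lean`: at any point the feasible-direction cones of the maximising cones tile space).
Putting these together at a point `y ∈ X` (a vertex of the hull):

* `facetsAt X y` — the facets containing `y`; `exists_mem_facetsAt` (every point of `X` lies on
  a facet: it is a unit vector, hence not interior to `conv X`, `not_mem_interior_convexHull`);
  `mem_facetsAt_iff` (they are exactly the maximisers of the facet functionals at `y`);
* `facetAngleAt X c y := 2π · ballFraction 0 (dirCone (argmaxCone (facetNormals X) c) y)` — the
  angle of the facet of `c` at `y`, defined intrinsically as the fraction of a small ball around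
  `y` (translated to `0`) occupied by the feasible directions of the cone over the facet;
  `facetAngleAt_eq_polyDih`: at the `j`-th vertex of the facet it is the dihedral angle
  `polyDih` there, i.e. `∠(perpTo y y₋, perpTo y y₊)` for the two neighbours `y₋, y₊` of `y` on
  the facet (`facetAngleAt_eq_angle`);
* **`sum_facetAngleAt`**: `Σ_{c ∈ facetsAt X y} facetAngleAt X c y = 2π` — the angles of the
  spherical polygons at a vertex of the subdivision sum to the full angle.

This is the per-vertex identity behind Legendre's count `Σ_f Σ_angles = 2π · #X` and the node
equations ("the angles around each node sum to `2π`") of the linear programs in Hales's proof of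
the Fejes Tóth kissing-twelve conjecture (arXiv:1209.6043, proof of Lemma 9, constraint 1), there
for the contact fan; here for the Delaunay (hull) subdivision, with no general-position
hypothesis.  Everything is PROVED; no named facts.

## References
* A.-M. Legendre, *Éléments de géométrie* (1794), VII.25. [folklore]
* T. C. Hales, arXiv:1209.6043 (2012), proof of Lemma 9 ("the angles around each node sum to
  `2π`"). [`Hales2012`]
-/

noncomputable section

namespace Literature.Geometry.DiscreteGeometry

open Real RealInnerProductSpace MeasureTheory Metric Set InnerProductGeometry

local notation "E3" => EuclideanSpace ℝ (Fin 3)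

section VertexAngles

variable {X : Finset E3}

/-- **The facets at a point `y`**: the facet normals `c` of `conv X` with `y` tight
(`⟪c, y⟫ = 1`, `y ∈ X`). [folklore] -/
def facetsAt (X : Finset E3) (y : E3) : Finset E3 :=
  (facetNormals X).filter fun c => y ∈ tightSet X c

/-- Membership in `facetsAt`. [folklore] -/
theorem mem_facetsAt {y c : E3} : c ∈ facetsAt X y ↔ c ∈ facetNormals X ∧ y ∈ tightSet X c := by
  unfold facetsAt; rw [Finset.mem_filter]

/-- **The angle of the facet of `c` at the point `y`, intrinsically**: `2π` times the fraction
of the unit ball (at `0`) occupied by the cone of feasible directions at `y` of the cone over the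
facet, `argmaxCone (facetNormals X) c`. [folklore] -/
def facetAngleAt (X : Finset E3) (c y : E3) : ℝ :=
  2 * π * ballFraction (0 : E3) (dirCone (argmaxCone (facetNormals X) c) y)

/-- **Every point of `X` lies on a facet** (`0 ∈ interior (conv X)`). [folklore] -/
theorem exists_mem_facetsAt (hX1 : ∀ y ∈ X, ‖y‖ = 1)
    (h0 : (0 : E3) ∈ interior (convexHull ℝ (X : Set E3))) {y : E3} (hy : y ∈ X) :
    ∃ c, c ∈ facetsAt X y := by
  obtain ⟨c, hc, hcy⟩ := exists_inner_eq_one_of_not_mem_interior h0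
    (subset_convexHull ℝ (X : Set E3) (Finset.mem_coe.2 hy))
    (not_mem_interior_convexHull hX1 hy)
  exact ⟨c, mem_facetsAt.2 ⟨hc, mem_tightSet.2 ⟨hy, hcy⟩⟩⟩

/-- **The facets at `y ∈ X` are exactly the maximisers of the facet functionals at `y`.**
[folklore] -/
theorem mem_facetsAt_iff (hX1 : ∀ y ∈ X, ‖y‖ = 1)
    (h0 : (0 : E3) ∈ interior (convexHull ℝ (X : Set E3))) {y : E3} (hy : y ∈ X) (c : E3) :
    c ∈ facetsAt X y ↔ c ∈ facetNormals X ∧ y ∈ argmaxCone (facetNormals X) c := by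
  have hyc : y ∈ convexHull ℝ (X : Set E3) := subset_convexHull ℝ (X : Set E3) (Finset.mem_coe.2 hy)
  obtain ⟨c₀, hc₀⟩ := exists_mem_facetsAt hX1 h0 hy
  have hy1 : ∃ c₀ ∈ facetNormals X, ⟪c₀, y⟫ = 1 :=
    ⟨c₀, (mem_facetsAt.1 hc₀).1, (mem_tightSet.1 (mem_facetsAt.1 hc₀).2).2⟩
  rw [mem_facetsAt]
  constructor
  · rintro ⟨hc, hyt⟩
    exact ⟨hc, (mem_argmaxCone_facetNormals_iff hyc hy1 hc).2 (mem_tightSet.1 hyt).2⟩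
  · rintro ⟨hc, hya⟩
    exact ⟨hc, mem_tightSet.2 ⟨hy, (mem_argmaxCone_facetNormals_iff hyc hy1 hc).1 hya⟩⟩

/-- **The angles of the facets at a vertex sum to `2π`.**  For a finite set `X` of unit
vectors of `ℝ³` with `0 ∈ interior (conv X)` and `y ∈ X`:
`Σ_{c ∈ facetsAt X y} facetAngleAt X c y = 2π`. [folklore] -/
theorem sum_facetAngleAt (hX1 : ∀ y ∈ X, ‖y‖ = 1)
    (h0 : (0 : E3) ∈ interior (convexHull ℝ (X : Set E3))) {y : E3} (hy : y ∈ X) :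
    ∑ c ∈ facetsAt X y, facetAngleAt X c y = 2 * π := by
  have hsum := sum_ballFraction_dirCone_argmaxCone (facetNormals X) (facetsAt X y) y
    (facetNormals_nonempty h0) (mem_facetsAt_iff hX1 h0 hy)
  unfold facetAngleAt
  rw [← Finset.mul_sum, hsum, mul_one]

/-- **The intrinsic angle is the dihedral angle of the facet at that vertex**: at the `j`-th
vertex `w j` of the facet of `c` (`w = facetVertex X c hc`, `m` vertices),
`facetAngleAt X c (w j) = polyDih m w j`. [folklore] -/
theorem facetAngleAt_eq_polyDih (hX1 : ∀ y ∈ X, ‖y‖ = 1)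
    (h0 : (0 : E3) ∈ interior (convexHull ℝ (X : Set E3))) {c : E3} (hc : c ∈ facetNormals X)
    {j : ℕ} (hj : j < (facetAngles X c (ne_zero_of_mem_facetNormals hX1 hc)).card) :
    facetAngleAt X c (facetVertex X c (ne_zero_of_mem_facetNormals hX1 hc) j) =
      polyDih (facetAngles X c (ne_zero_of_mem_facetNormals hX1 hc)).card
        (facetVertex X c (ne_zero_of_mem_facetNormals hX1 hc)) j := by
  set hc0 := ne_zero_of_mem_facetNormals hX1 hc
  have hm : 3 ≤ (facetAngles X c hc0).card := by
    rw [card_facetAngles hX1 hc0]; exact three_le_card_tightSet hc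
  have hw : ∀ i j k, i < j → j < k → k < (facetAngles X c hc0).card →
      0 < orient3 (facetVertex X c hc0 i) (facetVertex X c hc0 j) (facetVertex X c hc0 k) :=
    fun i j k hij hjk hk => orient3_facetVertex_pos hX1 hc hij hjk hk
  unfold facetAngleAt
  rw [argmaxCone_eq_polyCone hX1 h0 hc, ballFraction_dirCone_polyCone_vertex hm hw hj]
  field_simp

/-- **… explicitly, the angle between the components orthogonal to `y` of its two neighbours on
the facet**: `facetAngleAt X c (w j) = ∠(perpTo (w j) (w (j−1)), perpTo (w j) (w (j+1)))`
(indices mod `m`). [folklore] -/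
theorem facetAngleAt_eq_angle (hX1 : ∀ y ∈ X, ‖y‖ = 1)
    (h0 : (0 : E3) ∈ interior (convexHull ℝ (X : Set E3))) {c : E3} (hc : c ∈ facetNormals X)
    {j : ℕ} (hj : j < (facetAngles X c (ne_zero_of_mem_facetNormals hX1 hc)).card) :
    facetAngleAt X c (facetVertex X c (ne_zero_of_mem_facetNormals hX1 hc) j) =
      angle
        (perpTo (facetVertex X c (ne_zero_of_mem_facetNormals hX1 hc) j)
          (facetVertex X c (ne_zero_of_mem_facetNormals hX1 hc)
            ((j + (facetAngles X c (ne_zero_of_mem_facetNormals hX1 hc)).card - 1) %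
              (facetAngles X c (ne_zero_of_mem_facetNormals hX1 hc)).card)))
        (perpTo (facetVertex X c (ne_zero_of_mem_facetNormals hX1 hc) j)
          (facetVertex X c (ne_zero_of_mem_facetNormals hX1 hc)
            ((j + 1) % (facetAngles X c (ne_zero_of_mem_facetNormals hX1 hc)).card))) := by
  rw [facetAngleAt_eq_polyDih hX1 h0 hc hj, polyDih]

/-- **Every point of `X` is a vertex of each facet containing it**, with an index:
`y ∈ tightSet X c → ∃ j < m, facetVertex X c hc j = y` (restated from
`exists_facetVertex_eq` for use with `facetsAt`). [folklore] -/
theorem exists_facetVertex_eq_of_mem_facetsAt (hX1 : ∀ y ∈ X, ‖y‖ = 1) {y c : E3}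
    (h : c ∈ facetsAt X y) :
    ∃ j, j < (facetAngles X c (ne_zero_of_mem_facetNormals hX1 (mem_facetsAt.1 h).1)).card ∧
      facetVertex X c (ne_zero_of_mem_facetNormals hX1 (mem_facetsAt.1 h).1) j = y :=
  exists_facetVertex_eq hX1 _ (mem_facetsAt.1 h).2

/-- The intrinsic facet angle lies in `[0, 2π · ½] = [0, π]` (a dihedral wedge occupies at most
half of the ball). [folklore] -/
theorem facetAngleAt_nonneg (X : Finset E3) (c y : E3) : 0 ≤ facetAngleAt X c y := by
  unfold facetAngleAt
  exact mul_nonneg (by positivity) (ballFraction_nonneg _ _)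

end VertexAngles

end Literature.Geometry.DiscreteGeometry

end
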